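import Mathlib
import Summits.NavierStokesRegularity.NavierStokesRegularity.Theorems.L3TimeExponentPincerCritModulus
import Summits.NavierStokesRegularity.NavierStokesRegularity.Theorems.L3TimeExponentPincerSerrinEndpointRung
import Summits.NavierStokesRegularity.NavierStokesRegularity.Theorems.NoBlowupToClay
import HarnessLib.Audit
import HarnessLib

/-!
# L3TimeExponentPincer — BC2 guard: the full-class critical smoothing modulus is summit-strength

Support kernel for the crux `L3CascadeJaw` (item stmt-NavierStokesRegularity-19499), planner nsreg-p2
ROUND-12 §2d / §Seeds (s4): the kernel certificate that the FULL-CLASS critical smoothing modulus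
`CritSmoothingB := ∃ Φ, CritSmoothing Φ` of `…Theorems.L3TimeExponentPincerCritModulus`
(`‖u(t)‖_∞ ≤ √ν Φ(‖u₀‖₃/ν) t^{-1/2}` for every frame solution) implies Fefferman's (A) outright —
so it is a BC2 GUARD (a node at least as strong as the summit), never a route item; only its
swirl-free restriction `CritSmoothingNoSwirlB` is a calibration node.

* `eLpNorm_three_le_of_top_of_sq` — `‖f‖₃ ≤ ‖f‖_∞^{1/3} (∫|f|²)^{1/3}` (the case `q = 1` of
  `eLpNorm_three_rpow_le_of_top_two`).
* `hasSmoothExtensionPast_of_critSmoothing` — under `CritSmoothing Φ` every frame solution on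
  `[0,T)` is bounded in `L³` on the window `(T/2, T)` (sup bound `× ` energy), hence extends past `T`
  by the Escauriaza–Seregin–Šverák window criterion `hasSmoothExtensionPast_of_eLpNorm_three_le_near`
  (`…Theorems.L3TimeExponentPincerSerrinEndpointRung`, proved from the discharged `seregin_L3_blowup`).
* `navierStokesRegularity_of_critSmoothing`, `navierStokesRegularity_of_critSmoothingB` — with the
  tree theorem `navierStokesRegularity_of_noBlowup` (`Theorems/NoBlowupToClay.lean`):
  **`CritSmoothingB → NavierStokesRegularity`**.

WHAT THIS IS NOT: not NS regularity — `CritSmoothingB` is an OPEN node used as a hypothesis; this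
file only certifies its strength; the crux `L3CascadeJaw` is untouched; no crux claim.
-/

noncomputable section

namespace Summit.NavierStokesRegularity.NavierStokesRegularity.Theorems.L3TimeExponentPincerCritModulusGuard

open MeasureTheory Set Filter Literature.Analysis.FluidPDE
open Summit.NavierStokesRegularity.NavierStokesRegularity.Theorems.L3TimeExponentPincerQuantJaw
open Summit.NavierStokesRegularity.NavierStokesRegularity.Theorems.L3TimeExponentPincerCritModulus
open Summit.NavierStokesRegularity.NavierStokesRegularity.Theorems.L3TimeExponentPincerSerrinEndpointRung
open scoped ENNReal NNReal

/-- `‖f‖₃ ≤ ‖f‖_∞^{1/3} · (∫ |f|²)^{1/3}` (interpolation `L³ ⊂ L² ∩ L^∞`, the case `q = 1` of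
`eLpNorm_three_rpow_le_of_top_two`). -/
theorem eLpNorm_three_le_of_top_of_sq {α : Type*} [MeasurableSpace α] {μ : Measure α}
    {F : Type*} [NormedAddCommGroup F] {f : α → F} (hf : AEStronglyMeasurable f μ) :
    eLpNorm f 3 μ ≤ eLpNorm f ∞ μ ^ (1 / 3 : ℝ) * (∫⁻ x, ‖f x‖ₑ ^ 2 ∂μ) ^ (1 / 3 : ℝ) := by
  have h := eLpNorm_three_rpow_le_of_top_two hf (q := 1) zero_le_one
  rwa [ENNReal.rpow_one] at h

/-- **`CritSmoothing Φ` excludes blow-up.** A frame solution on `[0,T)` has `‖u(t)‖₃ ≤ K < ∞` on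
`(T/2, T)` with `K = (√ν Φ(‖u₀‖₃/ν) (T/2)^{-1/2})^{1/3} E₀^{1/3}`, hence extends smoothly past `T`
(ESS window criterion). -/
theorem hasSmoothExtensionPast_of_critSmoothing {Φ : ℝ → ℝ} (hΦ : CritSmoothing Φ) {ν T : ℝ}
    (hν : 0 < ν) (hT : 0 < T) {u : ℝ → E3 → E3} {pr : ℝ → E3 → ℝ}
    (hcl : IsClassicalNSSolutionOn (Ico 0 T) ν 0 u pr) (hLH : IsLerayHopfOn T ν 0 (u 0) u)
    (hdec : HasRapidSpatialDecay (u 0)) : HasSmoothExtensionPast ν 0 u T := by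
  have hA := eLpNorm_three_lt_top_of_hasRapidSpatialDecay hdec
  have hE := energy0_lt_top_of_hasRapidSpatialDecay hdec
  have hF : IsFrameSolution ν T u pr := ⟨hcl, hLH, hdec⟩
  set c : ℝ≥0∞ := ENNReal.ofReal (Real.sqrt ν * Φ ((eLpNorm (u 0) 3 volume).toReal / ν)) with hc
  have hsup : ∀ t ∈ Ioo 0 T,
      eLpNorm (u t) ∞ volume ≤ c * ENNReal.ofReal (t ^ (-(1 / 2 : ℝ))) :=
    fun t ht => hΦ ν T _ hν hT ENNReal.toReal_nonneg u pr hF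
      (by rw [ENNReal.ofReal_toReal hA.ne]) t ht
  set K : ℝ≥0∞ := (c * ENNReal.ofReal ((T / 2) ^ (-(1 / 2 : ℝ)))) ^ (1 / 3 : ℝ) *
    (energy0 u) ^ (1 / 3 : ℝ) with hK
  have h13 : (0 : ℝ) ≤ 1 / 3 := by norm_num
  have hKtop : K < ⊤ := by
    refine ENNReal.mul_lt_top ?_ ?_
    · exact ENNReal.rpow_lt_top_of_nonneg h13
        (ENNReal.mul_ne_top ENNReal.ofReal_ne_top ENNReal.ofReal_ne_top)
    · exact ENNReal.rpow_lt_top_of_nonneg h13 hE.ne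
  refine hasSmoothExtensionPast_of_eLpNorm_three_le_near hν hT hcl hLH hdec (T₂ := T / 2)
    (by linarith) hKtop fun t ht => ?_
  have ht0 : 0 < t := lt_trans (by linarith) ht.1
  refine (eLpNorm_three_le_of_top_of_sq (frame_aestronglyMeasurable hF ⟨ht0, ht.2⟩)).trans ?_
  have hmono : t ^ (-(1 / 2 : ℝ)) ≤ (T / 2) ^ (-(1 / 2 : ℝ)) :=
    Real.rpow_le_rpow_of_nonpos (by linarith) ht.1.le (by norm_num)
  have htop : eLpNorm (u t) ∞ volume ≤ c * ENNReal.ofReal ((T / 2) ^ (-(1 / 2 : ℝ))) :=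
    (hsup t ⟨ht0, ht.2⟩).trans (mul_le_mul' le_rfl (ENNReal.ofReal_le_ofReal hmono))
  have htwo : ∫⁻ x, ‖u t x‖ₑ ^ 2 ≤ energy0 u := frame_lintegral_sq_le_energy0 hν.le hF ⟨ht0.le, ht.2.le⟩
  rw [hK]
  gcongr

/-- **`CritSmoothing Φ → (A)`**: a finite full-class critical smoothing modulus excludes every
blow-up, hence gives Fefferman's (A) by `navierStokesRegularity_of_noBlowup`. -/
theorem navierStokesRegularity_of_critSmoothing {Φ : ℝ → ℝ} (hΦ : CritSmoothing Φ) :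
    NavierStokesRegularity :=
  navierStokesRegularity_of_noBlowup fun _ _ hν hT _ _ hcl hLH hdec =>
    hasSmoothExtensionPast_of_critSmoothing hΦ hν hT hcl hLH hdec

/-- **BC2 guard: `CritSmoothingB → NavierStokesRegularity`.** The full-class critical modulus is
summit-strength (at least as strong as (A)); it is a guard, not a route item. -/
theorem navierStokesRegularity_of_critSmoothingB (h : CritSmoothingB) : NavierStokesRegularity := by
  obtain ⟨Φ, hΦ⟩ := h
  exact navierStokesRegularity_of_critSmoothing hΦ

end Summit.NavierStokesRegularity.NavierStokesRegularity.Theorems.L3TimeExponentPincerCritModulusGuard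

end
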